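import Summits.BirchSwinnertonDyer.BirchSwinnertonDyer.Theorems.ThetaPartnerAtTwoSignedControlAtTwoShaTwoOfBridgeOfLocalGlobal
import Summits.BirchSwinnertonDyer.BirchSwinnertonDyer.Theorems.SchneiderFreeAdditiveX3PoitouTateReciprocitySumHolds
import Summits.BirchSwinnertonDyer.BirchSwinnertonDyer.Theorems.SchneiderFreeAdditiveX3PoitouTateReciprocityEqualityHolds
import HarnessLib

/-!
# The Ш²-cochain bridge, step (vii) THREADING: a homomorphism `h : N₁ → C̄` whose road-B readout functional
# `y ↦ inv(nat y ∘ ∂h)` VANISHES on `Ш¹(K, M^D)` has `Ψ h = 0` — the injective half of Milne I Thm. 4.10 (a) for an ARBITRARY `h`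

Route `SemiOrdinaryEisensteinDescent` (BSD, rung W-ALL row 2·3@3), Kolyvagin column, Cassels–Tate lane: print item
`CasselsTateLevelInputsFact` (stmt-BirchSwinnertonDyer-20191), whose one remaining input for THE canonical invariant maps is `hPTc`
(p628097).  The bridge from cell bsd-schneider's obstruction map `Ψ = HomDual.shaTwoConnecting` to `hPTc` is the memo
`Cruxes/WildKolyvaginUpperAtThree/SHA2-BRIDGE-w3g7.md`; its chain after `…ShaTwoCochainThetaExhaustion` (p635669: `[f] = 0 ⟸ Ψ h = 0`
for the exhausting `h`) needs the link

  **(vii-THR)** `(∀ y ∈ Ш¹(K, M^D), inv((nat y) ∘ ∂h) = 0) ⟹ Ψ h = 0`,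

the INJECTIVE HALF of road B's perfect pairing (`PoitouTateShaTwoReadout.shaTwo_tateDual_of_presentation_readout_real`, whose
statement only exposes `∃ b bijective` and so cannot be re-entered by name) restated for an ARBITRARY `h` rather than the chosen
lift `h_c` of a class.  Proof (memo §1 (vii), "road B's injectivity-modulo-local-sums"): the functional `E_h : y ↦ inv(nat y ∘ ∂h)` on
`H¹(K, M^D)` lifts to `ℤ/n` (`exists_addMonoidHom_zmodToQmodZ_eq`); it kills `Ш¹(K, M^D)`, so by the ANNIHILATOR theorem for THE
maps (`SignedEC.MuReal.exists_family_sum_localTatePairing_eq_real`: `Ш¹(K, M^D)^⊥ = γ¹(P¹)`, archimedean components live;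
inputs `canonical_isPerfect`, `canonical_injectiveAtRealPlaces`, Milne I 2.6 at all levels, `SelmerComplement`) it is a sum of
local Tate pairings against ONE family `t`; by (R3) `t` is the readout of some `f : N₁ → J̄`, and by (R4) the functional of
`f ≫ g` is that same sum; so `E_h = E_{f ≫ g}`, whence `∂h = ∂(f ≫ g)` (`nat` onto, `α¹` injective), `h = f ≫ g + ι ≫ q`
(`boundary_eq_boundary_iff`) and `Ψ h = Ψ(f ≫ g) + Ψ(ι ≫ q) = 0`.

* §1 `psi_eq_zero_of_forall_sha_readout_eq_zero` — the ABSTRACT road form (hypotheses ⊆ those of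
  `shaTwo_tateDual_of_presentation_readout_real`: `hcomp`, `S₀`, `inv`, `hS`, `α¹` injective, `R`/(R3), `nat` onto/(R4), `Ψ` with
  `Ψ(f ≫ g) = 0`, `Ψ(ι ≫ q) = 0`; NOT needed: `hΨker`, `hΨsha`, `hΨsurj`, `Ext¹(N₂, C̄) = 0`, finiteness of `Ш¹`).
* §2 `shaTwoConnecting_eq_zero_of_forall_sha_readout_eq_zero` — RUN on door-c4's canonical presentation with the NATIVE
  `Ψ := shaTwoConnecting ρ₀ n hM`, readout `R_v := HomDual.readout ρ₀ n hM (π v)`, the Tate-duality record `(inv, hT)` giving `α¹`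
  injective (`tateDuality_finite`), `S₀ := exists_finset_place_isUnramifiedAt`; displayed: `hcomp`, `π`/(R3), `nat`/(R4).
* §3 `shaTwoConnecting_eq_zero_of_forall_sha_classBarInv_eq_zero` — THE maps all the way: `inv := classBarInv K`
  (`tateDualityHypotheses_classBarD_classBarInv`, door-c4), `π := IdeleReadout.ideleProjection K` (door-c5), (R3) :=
  `exists_readout_eq_of_assembly … (IdeleReadout.ideleAssembly n ρ₀ hM)` (doors c5/c6), `hcomp := selmerComplement_canonical_holds`
  (door-c4 g18); displayed ONLY the bridge `nat` with its (R4) identity — exactly the binder of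
  `poitouTate_sha_tateDual_of_bridge_of_localGlobal`, discharged in the tree by `hR4_ideleProjection` for
  `nat := −(Φ⁻¹ ∘ H¹(κ))` (door-c5); the S4 assembler instantiates `nat` with the term its S3b identity is written against.
* §4 `shaTwoConnecting_eq_zero_of_forall_sha_classBarInv_extOneEquiv_symm_eq_zero` — NOTHING displayed but a biduality pair
  `(ι, κ)` (door-c4's `exists_bidual_intertwining`): with door-c5's bridge `nat := −(Φ⁻¹ ∘ H¹(κ))` (`nat_bijective`,
  `hR4_ideleProjection_of_readoutUnramified`, `hRur_holds`) the hypothesis reads on `Ш¹(K, M₀)` itself: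
  **`(∀ y ∈ Ш¹(K, M₀), classBarInv(Φ⁻¹ y ∘ ∂h) = 0) ⟹ shaTwoConnecting ρ₀ n hM h = 0`** — the form in which the memo's (vi)
  (`classBarInv K (Inf_E c ∘ ∂h)`, `y = Φ(Inf_E c)`) delivers the readout value.

THEOREMS ONLY (no definition, no instance, no named fact); a re-threading of landed road-B steps — no case of BSD, Poitou–Tate or
Cassels–Tate is proved here.  Width seat `bsd-wall-soed-p2-w4` g2; `--supports stmt-BirchSwinnertonDyer-20480`, helper; route-free.

## References
* [MilneADT2006] J. S. Milne, *Arithmetic Duality Theorems*, 2nd ed. (2006), Ch. I Thm. 4.10 (a) and its proof (p. 57–58: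
  `Ш¹(K, M^D)^⊥ ⊆ γ¹(P¹(K, M))`, injectivity of `Ш² → Ш¹*`), Lemma 4.13, Thm. 2.13 (a), Ex. 1.6 (c).
* [Harari2020] D. Harari, *Galois Cohomology and Class Field Theory* (2020), Thm. 17.13 (b), §16.3.
* [Howard2004HeegnerKolyvagin] B. Howard, Compositio Math. 140 (2004), Thm. 2.1.11 (the complement property).
-/

noncomputable section

open Function NumberField IsDedekindDomain CategoryTheory CategoryTheory.Abelian
open scoped NumberField ContRepresentation

-- `Summit.<P>.<Sub>` repeats `BirchSwinnertonDyer` by the tree's layout convention (D-0017)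
set_option linter.dupNamespace false
set_option autoImplicit false

namespace Summit.BirchSwinnertonDyer.BirchSwinnertonDyer.Theorems.ShaTwoCochainTheta

open Field
open Literature.NumberTheory.GaloisRepresentations Literature.NumberTheory.GaloisCohomology
open Literature.NumberTheory.GaloisRepresentations.DiscreteGaloisModule (TateDual tateDual localTatePairingZMod
  unramifiedSubgroup sha shaTwo)
open Literature.Algebra.Homology Literature.Algebra.Homology.DiscreteRep Literature.Algebra.Homology.ExtPresentation
open Literature.NumberTheory.GaloisRepresentations.IdeleClassBar (classBarD classBarInv tateDualityHypotheses_classBarD_classBarInv)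
open Literature.AnabelianGeometry.AbsoluteAnabelian.Prop121vii (zmodToQmodZ zmodToQmodZ_injective)
open Literature.NumberTheory.GaloisRepresentations.FreePresentation (presentationComplex presentationComplex_shortExact
  presLattice presentationLayer presentationRank)
open Literature.NumberTheory.GaloisRepresentations.HomDual (IdeleProjection readout shaTwoConnecting shaTwoConnecting_comp_g'
  shaTwoConnecting_f_comp)
open Summit.BirchSwinnertonDyer.BirchSwinnertonDyer.Theorems.SignedEC.MuReal (exists_family_sum_localTatePairing_eq_real
  exists_finset_place_isUnramifiedAt)
open Summit.BirchSwinnertonDyer.BirchSwinnertonDyer.Theorems.SchneiderFreeAdditiveX3.PoitouTateReduction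
  (unramifiedOrthogonal_of_isPerfect_allLevels exists_readout_eq_of_assembly selmerComplement_canonical_holds
    nat_bijective hR4_ideleProjection_of_readoutUnramified hRur_holds)
open Literature.NumberTheory.GaloisRepresentations.OpenLayer (extOneEquiv)
open Summit.BirchSwinnertonDyer.BirchSwinnertonDyer.Theorems.KolyvaginRoadThreePT
  (exists_finset_localization_mem_unramifiedSubgroup)
open Summit.BirchSwinnertonDyer.BirchSwinnertonDyer.Theorems.PoitouTateShaTwoReadout (exists_addMonoidHom_zmodToQmodZ_eq)

variable {K : Type} [Field K] [NumberField K]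

/-! ## §1 The abstract road form -/

/-- **(vii-THR), abstract road form: a homomorphism `h : N₁ → C̄` whose readout functional `y ↦ inv(nat y ∘ ∂h)` vanishes on
`Ш¹(K, M^D)` lies in the kernel of `Ψ`.**  Setting: `n ≥ 1`; `ρ` a finite discrete `n`-torsion `Γ_K`-module unramified off the
finite `S₀ ⊇ {v ∣ ∞} ∪ {v ∣ n}`; the canonical local invariant maps satisfy `SelmerComplement` at level `n`; a short exact
`S : 0 → N₁ → N₂ → N → 0` in `C_Γ`, an invariant map `inv` of `C̄` with `α¹(Γ_K, N)` injective; a readout `R_v : Hom(N₁, J̄) → H¹(K_v, M)`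
with (R3) (archimedean components live); an additive SURJECTION `nat : H¹(K, M^D) → Ext¹(ℤ, N)` with the identity (R4); an
additive `Ψ : Hom(N₁, C̄) → H²(K, M)` killing `f ≫ g` and `ι ≫ q`.  Conclusion: `Ψ h = 0`.  (Annihilator of `Ш¹` = local sums
(Milne I 4.10, (b) ⟹ (a)); (R3) realises the family as a readout; (R4) identifies the two functionals; `α¹ ∘ ∂` separates
`Hom(N₁, C̄)` modulo `ι ≫ Hom(N₂, C̄)`.)
[cite: MilneADT2006, Ch. I, Thm. 4.10 (a) (proof, pp. 57–58), Thm. 2.13 (a), Lemma 4.13][cite: Harari2020, Thm. 17.13 (b)]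
[cite: Howard2004HeegnerKolyvagin, Thm. 2.1.11] -/
theorem psi_eq_zero_of_forall_sha_readout_eq_zero {n : ℕ} [NeZero n]
    (hcomp : (LocalInvariants.canonical K n).SelmerComplement)
    {M : Type} [AddCommGroup M] [TopologicalSpace M] [DiscreteTopology M] [Finite M]
    (ρ : DiscreteGaloisModule K M) (hM : ∀ m : M, n • m = 0)
    (S₀ : Finset (Place K)) (hinf : ∀ w : InfinitePlace K, (Sum.inl w : Place K) ∈ S₀)
    (hS₀ : ∀ v : HeightOneSpectrum (𝓞 K), (Sum.inr v : Place K) ∉ S₀ →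
      ((n : ℕ) : 𝓞 K) ∉ v.asIdeal ∧ GaloisRep.IsUnramifiedAt v ρ)
    (inv : Abelian.Ext (triv (Γ := absoluteGaloisGroup K) ℤ) (classBarD K) 2 →+ AddCircle (1 : ℚ))
    {S : ShortComplex (DiscreteRepCat ℤ (absoluteGaloisGroup K))} (hS : S.ShortExact)
    (hα : Function.Injective
      (ExtDuality.adjointMap (P := triv (Γ := absoluteGaloisGroup K) ℤ) inv S.X₃ (rfl : 1 + 1 = 2)))
    (R : ∀ v : Place K, (S.X₁ ⟶ (ideleClassLimitShortComplex K).X₂) →+ galoisCohomology (ρ.toLocal v) 1)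
    (hR3 : ∀ T : Finset (Place K), (∀ w : InfinitePlace K, (Sum.inl w : Place K) ∈ T) →
      (∀ v : HeightOneSpectrum (𝓞 K), (Sum.inr v : Place K) ∉ T →
        ((n : ℕ) : 𝓞 K) ∉ v.asIdeal ∧ GaloisRep.IsUnramifiedAt v ρ) →
      ∀ t : Π v : Place K, galoisCohomology (ρ.toLocal v) 1,
        (∀ v : HeightOneSpectrum (𝓞 K), (Sum.inr v : Place K) ∉ T →
          t (Sum.inr v) ∈ unramifiedSubgroup (GaloisRep.toLocal v ρ) 1) →
        ∃ f : S.X₁ ⟶ (ideleClassLimitShortComplex K).X₂, ∀ v : Place K, R v f = t v)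
    (nat : galoisCohomology (ρ.tateDual n) 1 →+ Abelian.Ext (triv (Γ := absoluteGaloisGroup K) ℤ) S.X₃ 1)
    (hnat : Function.Surjective nat)
    (hR4 : ∀ f : S.X₁ ⟶ (ideleClassLimitShortComplex K).X₂, ∃ Tf : Finset (Place K),
      ∀ (y : galoisCohomology (ρ.tateDual n) 1) (T' : Finset (Place K)), Tf ⊆ T' →
        (∀ v : HeightOneSpectrum (𝓞 K), (Sum.inr v : Place K) ∉ T' →
          galoisCohomology.localization (ρ.tateDual n) (Sum.inr v) 1 y ∈
            unramifiedSubgroup (GaloisRep.toLocal v (ρ.tateDual n)) 1) →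
        zmodToQmodZ n (∑ v ∈ T', localTatePairingZMod ρ n v (LocalInvariants.canonical K n v) (R v f)
          (galoisCohomology.localization (ρ.tateDual n) v 1 y)) =
        inv ((nat y).comp (boundary hS (classBarD K) (f ≫ (ideleClassLimitShortComplex K).g))
          (rfl : 1 + 1 = 2)))
    (Ψ : (S.X₁ ⟶ classBarD K) →+ galoisCohomology ρ 2)
    (hΨg : ∀ f : S.X₁ ⟶ (ideleClassLimitShortComplex K).X₂, Ψ (f ≫ (ideleClassLimitShortComplex K).g) = 0)
    (hΨf : ∀ q : S.X₂ ⟶ classBarD K, Ψ (S.f ≫ q) = 0)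
    (h : S.X₁ ⟶ classBarD K)
    (hvan : ∀ y ∈ sha (ρ.tateDual n), inv ((nat y).comp (boundary hS (classBarD K) h) (rfl : 1 + 1 = 2)) = 0) :
    Ψ h = 0 := by
  classical
  -- `H¹(K, M^D)` is `n`-torsion
  have hN1 : ∀ y : galoisCohomology (ρ.tateDual n) 1, n • y = 0 := fun y =>
    galoisCohomology.nsmul_eq_zero_of_forall _ (fun f => DiscreteGaloisModule.TateDual.nsmul_eq_zero f) y
  -- the `ℚ/ℤ`-valued functional `y ↦ inv (nat y ∘ ∂ h')` of a homomorphism `h' : N₁ → C̄`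
  let EH : (S.X₁ ⟶ classBarD K) → (galoisCohomology (ρ.tateDual n) 1 →+ AddCircle (1 : ℚ)) := fun h' =>
    (ExtDuality.adjointMap (P := triv (Γ := absoluteGaloisGroup K) ℤ) inv S.X₃ (rfl : 1 + 1 = 2)
      (boundary hS (classBarD K) h')).comp nat
  have hEH : ∀ (h' : S.X₁ ⟶ classBarD K) (y : galoisCohomology (ρ.tateDual n) 1),
      EH h' y = inv ((nat y).comp (boundary hS (classBarD K) h') (rfl : 1 + 1 = 2)) := fun _ _ => rfl
  -- its `ℤ/n`-valued lift, vanishing on `Ш¹(K, M^D)`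
  obtain ⟨φ, hφ⟩ := exists_addMonoidHom_zmodToQmodZ_eq hN1 (EH h)
  have hφsha : ∀ y ∈ sha (ρ.tateDual n), φ y = 0 := fun y hy => by
    apply zmodToQmodZ_injective n
    rw [hφ, hEH, hvan y hy, map_zero]
  -- the annihilator of `Ш¹(K, M^D)` consists of sums of local Tate pairings against ONE family (THE maps, archimedean live)
  obtain ⟨S₁, t, hS₀S₁, htur, hformula⟩ :=
    exists_family_sum_localTatePairing_eq_real LocalInvariants.canonical_isPerfect
      LocalInvariants.canonical_injectiveAtRealPlaces
      (unramifiedOrthogonal_of_isPerfect_allLevels _ LocalInvariants.canonical_isPerfect) hcomp ρ hM S₀ hinf hS₀ φ hφsha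
  -- (R3): the family is the readout of one `f : N₁ → J̄`
  obtain ⟨f, hf⟩ := hR3 S₁ (fun w => hS₀S₁ (hinf w)) (fun v hv => hS₀ v fun hv' => hv (hS₀S₁ hv')) t htur
  obtain ⟨Tf, hTf⟩ := hR4 f
  -- every class is unramified off a finite set of places containing any given finite set
  have hur_y : ∀ (y : galoisCohomology (ρ.tateDual n) 1) (T₀ : Finset (Place K)), ∃ T' : Finset (Place K),
      T₀ ⊆ T' ∧ ∀ v : HeightOneSpectrum (𝓞 K), (Sum.inr v : Place K) ∉ T' →
        galoisCohomology.localization (ρ.tateDual n) (Sum.inr v) 1 y ∈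
          unramifiedSubgroup (GaloisRep.toLocal v (ρ.tateDual n)) 1 := by
    intro y T₀
    obtain ⟨Ty, hTy⟩ := exists_finset_localization_mem_unramifiedSubgroup (ρ.tateDual n) y
    refine ⟨T₀ ∪ Ty.image Sum.inr, Finset.subset_union_left, fun v hv => hTy v fun hvT => hv ?_⟩
    exact Finset.mem_union_right _ (Finset.mem_image_of_mem _ hvT)
  -- the functionals of `h` and of `f ≫ g` agree on every class
  have hfun : EH h = EH (f ≫ (ideleClassLimitShortComplex K).g) := by
    ext y
    obtain ⟨S', hS', hy⟩ := hur_y y (S₁ ∪ Tf)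
    have h1 : φ y = ∑ v ∈ S', localTatePairingZMod ρ n v (LocalInvariants.canonical K n v) (R v f)
        (galoisCohomology.localization (ρ.tateDual n) v 1 y) := by
      rw [hformula y S' (Finset.union_subset_left hS') hy]
      exact Finset.sum_congr rfl fun v _ => by rw [hf v]
    rw [← hφ, h1, hTf y S' (Finset.union_subset_right hS') hy, hEH]
  -- hence `∂h = ∂(f ≫ g)`, `h = f ≫ g + ι ≫ q`, and `Ψ h = 0`
  have h1 : ExtDuality.adjointMap (P := triv (Γ := absoluteGaloisGroup K) ℤ) inv S.X₃ (rfl : 1 + 1 = 2)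
      (boundary hS (classBarD K) h) =
      ExtDuality.adjointMap (P := triv (Γ := absoluteGaloisGroup K) ℤ) inv S.X₃ (rfl : 1 + 1 = 2)
      (boundary hS (classBarD K) (f ≫ (ideleClassLimitShortComplex K).g)) :=
    (AddMonoidHom.cancel_right hnat).1 hfun
  obtain ⟨q, hq⟩ := (boundary_eq_boundary_iff hS h (f ≫ (ideleClassLimitShortComplex K).g)).1 (hα h1)
  rw [hq, map_add, hΨf, add_zero, hΨg]

/-! ## §2 Run on the canonical presentation with the native obstruction map -/

/-- **(vii-THR) for the NATIVE obstruction map `Ψ = shaTwoConnecting ρ₀ n hM` on door-c4's canonical presentation**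
`0 → N₁ → ℤ[Gal(E₀/K)]ᵐ → M₀ → 0` (module `ρ₀^D`, idèle readout `R_v := HomDual.readout ρ₀ n hM (π v)`, a Tate-duality record
`(inv, hT)` for `C̄`): if the readout functional of `h : N₁ → C̄` vanishes on `Ш¹(K, M₀^{DD})` then `shaTwoConnecting ρ₀ n hM h = 0`.
Displayed: `SelmerComplement` at level `n`, the family `π` with (R3), the bridge `nat` (onto) with (R4) — verbatim binders of
`shaTwo_tateDual_of_ideleProjection_real`; `α¹` injective is `tateDuality_finite hT`, `Ψ(f ≫ g) = 0` / `Ψ(ι ≫ q) = 0` are door-c5's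
`shaTwoConnecting_comp_g'` / `shaTwoConnecting_f_comp`, the ramification set is produced inside.
[cite: MilneADT2006, Ch. I, Thm. 4.10 (a) (proof, pp. 57–58), Lemma 4.13, Thm. 1.8][cite: Harari2020, Thm. 17.13 (b)] -/
theorem shaTwoConnecting_eq_zero_of_forall_sha_readout_eq_zero {n : ℕ} [NeZero n]
    (hcomp : (LocalInvariants.canonical K n).SelmerComplement)
    (inv : Abelian.Ext (triv (Γ := absoluteGaloisGroup K) ℤ) (classBarD K) 2 →+ AddCircle (1 : ℚ))
    (hT : TateDualityHypotheses (classBarD K) inv) (π : ∀ v : Place K, IdeleProjection K v)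
    {M : Type} [AddCommGroup M] [TopologicalSpace M] [DiscreteTopology M] [Finite M] [Finite (TateDual K M n)]
    (ρ₀ : DiscreteGaloisModule K M) (hM : ∀ m : M, n • m = 0)
    (hR3 : ∀ T : Finset (Place K), (∀ w : InfinitePlace K, (Sum.inl w : Place K) ∈ T) →
      (∀ v : HeightOneSpectrum (𝓞 K), (Sum.inr v : Place K) ∉ T →
        ((n : ℕ) : 𝓞 K) ∉ v.asIdeal ∧ GaloisRep.IsUnramifiedAt v (ρ₀.tateDual n)) →
      ∀ t : Π v : Place K, galoisCohomology ((ρ₀.tateDual n).toLocal v) 1,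
        (∀ v : HeightOneSpectrum (𝓞 K), (Sum.inr v : Place K) ∉ T →
          t (Sum.inr v) ∈ unramifiedSubgroup (GaloisRep.toLocal v (ρ₀.tateDual n)) 1) →
        ∃ f : (presentationComplex ρ₀).X₁ ⟶ (ideleClassLimitShortComplex K).X₂,
          ∀ v : Place K, readout ρ₀ n hM (π v) f = t v)
    (nat : galoisCohomology ((ρ₀.tateDual n).tateDual n) 1 →+
      Abelian.Ext (triv (Γ := absoluteGaloisGroup K) ℤ) (presentationComplex ρ₀).X₃ 1)
    (hnat : Function.Surjective nat)
    (hR4 : ∀ f : (presentationComplex ρ₀).X₁ ⟶ (ideleClassLimitShortComplex K).X₂, ∃ Tf : Finset (Place K),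
      ∀ (y : galoisCohomology ((ρ₀.tateDual n).tateDual n) 1) (T' : Finset (Place K)), Tf ⊆ T' →
        (∀ v : HeightOneSpectrum (𝓞 K), (Sum.inr v : Place K) ∉ T' →
          galoisCohomology.localization ((ρ₀.tateDual n).tateDual n) (Sum.inr v) 1 y ∈
            unramifiedSubgroup (GaloisRep.toLocal v ((ρ₀.tateDual n).tateDual n)) 1) →
        zmodToQmodZ n (∑ v ∈ T', localTatePairingZMod (ρ₀.tateDual n) n v (LocalInvariants.canonical K n v)
          (readout ρ₀ n hM (π v) f)
          (galoisCohomology.localization ((ρ₀.tateDual n).tateDual n) v 1 y)) =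
        inv ((nat y).comp (boundary (presentationComplex_shortExact ρ₀) (classBarD K)
          (f ≫ (ideleClassLimitShortComplex K).g)) (rfl : 1 + 1 = 2)))
    (h : (presentationComplex ρ₀).X₁ ⟶ classBarD K)
    (hvan : ∀ y ∈ sha ((ρ₀.tateDual n).tateDual n),
      inv ((nat y).comp (boundary (presentationComplex_shortExact ρ₀) (classBarD K) h) (rfl : 1 + 1 = 2)) = 0) :
    shaTwoConnecting ρ₀ n hM h = 0 := by
  haveI := absoluteGaloisGroup_compactSpace K
  haveI : Finite (presentationComplex ρ₀).X₃.obj.V := ‹Finite M›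
  have hα : Function.Bijective
      (ExtDuality.adjointMap (P := triv (Γ := absoluteGaloisGroup K) ℤ) inv (presentationComplex ρ₀).X₃
        (rfl : 1 + 1 = 2)) :=
    (tateDuality_finite hT (presentationComplex ρ₀).X₃).2.1
  obtain ⟨S₀, hinf, hS₀⟩ := exists_finset_place_isUnramifiedAt (ρ₀.tateDual n) n
  exact psi_eq_zero_of_forall_sha_readout_eq_zero hcomp (ρ₀.tateDual n)
    (fun Φ => DiscreteGaloisModule.TateDual.nsmul_eq_zero Φ) S₀ hinf hS₀ inv (presentationComplex_shortExact ρ₀) hα.1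
    (fun v => readout ρ₀ n hM (π v)) hR3 nat hnat hR4 (shaTwoConnecting ρ₀ n hM)
    (fun f => shaTwoConnecting_comp_g' ρ₀ n hM f) (shaTwoConnecting_f_comp ρ₀ n hM) h hvan

/-! ## §3 THE maps all the way: `classBarInv`, THE idèle projections, (R3) and `SelmerComplement` discharged -/

/-- **(vii-THR) with every door discharged but the bridge `nat`**: for `inv := classBarInv K` (door-c4's Tate-duality record
`tateDualityHypotheses_classBarD_classBarInv`), `π := IdeleReadout.ideleProjection K` (door-c5), (R3) from door-c5's idèle assembly
through door-c6's readout surjectivity (`exists_readout_eq_of_assembly … (IdeleReadout.ideleAssembly n ρ₀ hM)`), and Howard's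
complement property of THE canonical family (`selmerComplement_canonical_holds`, door-c4 g18): **if an additive surjection
`nat : H¹(K, M₀^{DD}) → Ext¹(ℤ, M₀)` satisfies the (R4) identity for THE idèle readout and the readout functional
`y ↦ classBarInv(nat y ∘ ∂h)` of `h : N₁ → C̄` vanishes on `Ш¹(K, M₀^{DD})`, then `shaTwoConnecting ρ₀ n hM h = 0`.**  The displayed
`(nat, R4)` binder is verbatim that of `poitouTate_sha_tateDual_of_bridge_of_localGlobal`, discharged in the tree by door-c5's
`hR4_ideleProjection` for `nat := −(Φ⁻¹ ∘ H¹(κ))` (`Φ = OpenLayer.extOneEquiv ρ₀`, `(ι, κ)` a biduality pair).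
[cite: MilneADT2006, Ch. I, Thm. 4.10 (a) (proof, pp. 57–58), Lemma 4.13, Thm. 1.8][cite: CasselsFrohlichANT1967, Ch. VII §11.2 (bis)]
[cite: Howard2004HeegnerKolyvagin, Thm. 2.1.11] -/
theorem shaTwoConnecting_eq_zero_of_forall_sha_classBarInv_eq_zero {n : ℕ} [NeZero n]
    {M : Type} [AddCommGroup M] [TopologicalSpace M] [DiscreteTopology M] [Finite M] [Finite (TateDual K M n)]
    (ρ₀ : DiscreteGaloisModule K M) (hM : ∀ m : M, n • m = 0)
    (nat : galoisCohomology ((ρ₀.tateDual n).tateDual n) 1 →+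
      Abelian.Ext (triv (Γ := absoluteGaloisGroup K) ℤ) (presentationComplex ρ₀).X₃ 1)
    (hnat : Function.Surjective nat)
    (hR4 : ∀ f : (presentationComplex ρ₀).X₁ ⟶ (ideleClassLimitShortComplex K).X₂, ∃ Tf : Finset (Place K),
      ∀ (y : galoisCohomology ((ρ₀.tateDual n).tateDual n) 1) (T' : Finset (Place K)), Tf ⊆ T' →
        (∀ v : HeightOneSpectrum (𝓞 K), (Sum.inr v : Place K) ∉ T' →
          galoisCohomology.localization ((ρ₀.tateDual n).tateDual n) (Sum.inr v) 1 y ∈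
            unramifiedSubgroup (GaloisRep.toLocal v ((ρ₀.tateDual n).tateDual n)) 1) →
        zmodToQmodZ n (∑ v ∈ T', localTatePairingZMod (ρ₀.tateDual n) n v (LocalInvariants.canonical K n v)
          (readout ρ₀ n hM (IdeleReadout.ideleProjection K v) f)
          (galoisCohomology.localization ((ρ₀.tateDual n).tateDual n) v 1 y)) =
        classBarInv K ((nat y).comp (boundary (presentationComplex_shortExact ρ₀) (classBarD K)
          (f ≫ (ideleClassLimitShortComplex K).g)) (rfl : 1 + 1 = 2)))
    (h : (presentationComplex ρ₀).X₁ ⟶ classBarD K)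
    (hvan : ∀ y ∈ sha ((ρ₀.tateDual n).tateDual n),
      classBarInv K ((nat y).comp (boundary (presentationComplex_shortExact ρ₀) (classBarD K) h) (rfl : 1 + 1 = 2)) = 0) :
    shaTwoConnecting ρ₀ n hM h = 0 :=
  shaTwoConnecting_eq_zero_of_forall_sha_readout_eq_zero (selmerComplement_canonical_holds K n) (classBarInv K)
    (tateDualityHypotheses_classBarD_classBarInv K) (IdeleReadout.ideleProjection K) ρ₀ hM
    (exists_readout_eq_of_assembly (IdeleReadout.ideleProjection K) ρ₀ hM (IdeleReadout.ideleAssembly (K := K) n ρ₀ hM))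
    nat hnat hR4 h hvan

/-! ## §4 Nothing displayed: door-c5's bridge `nat := −(Φ⁻¹ ∘ H¹(κ))`, hypothesis on `Ш¹(K, M₀)` itself -/

/-- **(vii-THR), THE maps, door-c5's bridge plugged: `(∀ y ∈ Ш¹(K, M₀), classBarInv(Φ⁻¹ y ∘ ∂h) = 0) ⟹ Ψ h = 0`** for the
native `Ψ = shaTwoConnecting ρ₀ n hM`, `Φ = OpenLayer.extOneEquiv ρ₀ : Ext¹(ℤ, M₀) ≅ H¹(K, M₀)` (door-c5's inflation bijection)
and any biduality pair `(ι, κ)` between `M₀` and `M₀^{DD}` (door-c4's `exists_bidual_intertwining` provides one): the bridge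
`nat := −(Φ⁻¹ ∘ H¹(κ))` is bijective (`nat_bijective`) and satisfies (R4) for THE idèle readout
(`hR4_ideleProjection_of_readoutUnramified` with `hRur_holds`), `H¹(κ)` carries `Ш¹(K, M₀^{DD})` into `Ш¹(K, M₀)`
(naturality of localisation, `galoisCohomology.res_map_one`), and `(−x) ∘ ∂h = −(x ∘ ∂h)`.  This is the shape in which the
bridge's invariant computation (memo §1 (vi): `classBarInv K (Inf_E c ∘ ∂h)` with `y = Φ(Inf_E c)`) is consumed.
[cite: MilneADT2006, Ch. I, Thm. 4.10 (a) (proof, pp. 57–58), Lemma 4.13, Prop. 0.19][cite: CasselsFrohlichANT1967, Ch. VII §11.2 (bis)] -/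
theorem shaTwoConnecting_eq_zero_of_forall_sha_classBarInv_extOneEquiv_symm_eq_zero {n : ℕ} [NeZero n]
    {M : Type} [AddCommGroup M] [TopologicalSpace M] [DiscreteTopology M] [Finite M] [Finite (TateDual K M n)]
    (ρ₀ : DiscreteGaloisModule K M) (hM : ∀ m : M, n • m = 0)
    (ι : ρ₀.toContRepresentation →ⁱL ((ρ₀.tateDual n).tateDual n).toContRepresentation)
    (κ : ((ρ₀.tateDual n).tateDual n).toContRepresentation →ⁱL ρ₀.toContRepresentation)
    (hι : ∀ (m : M) (g : TateDual K M n), ι m g = g m) (hκι : ∀ m : M, κ (ι m) = m)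
    (hικ : ∀ φ : TateDual K (TateDual K M n) n, ι (κ φ) = φ)
    (h : (presentationComplex ρ₀).X₁ ⟶ classBarD K)
    (hvan : ∀ y ∈ sha ρ₀,
      classBarInv K (((extOneEquiv ρ₀).symm y).comp (boundary (presentationComplex_shortExact ρ₀) (classBarD K) h)
        (rfl : 1 + 1 = 2)) = 0) :
    shaTwoConnecting ρ₀ n hM h = 0 := by
  refine shaTwoConnecting_eq_zero_of_forall_sha_classBarInv_eq_zero ρ₀ hM
    (-((AddMonoidHom.id (Abelian.Ext (triv (Γ := absoluteGaloisGroup K) ℤ) (presentationComplex ρ₀).X₃ 1)).comp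
      (((extOneEquiv ρ₀).symm.toAddMonoidHom).comp (galoisCohomology.map κ 1))))
    (nat_bijective ρ₀ ι κ hκι hικ).2
    (hR4_ideleProjection_of_readoutUnramified ρ₀ hM ι κ hι hκι hικ (hRur_holds ρ₀ hM)) h fun y hy => ?_
  -- `H¹(κ)` carries `Ш¹(K, M₀^{DD})` into `Ш¹(K, M₀)`
  have hκy : galoisCohomology.map κ 1 y ∈ sha ρ₀ := by
    refine (DiscreteGaloisModule.mem_sha_iff ρ₀ _).2 fun v => ?_
    change galoisCohomology.res ρ₀ (Place.Completion v) 1 (galoisCohomology.map κ 1 y) = 0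
    rw [galoisCohomology.res_map_one]
    have hv : galoisCohomology.res ((ρ₀.tateDual n).tateDual n) (Place.Completion v) 1 y = 0 :=
      (DiscreteGaloisModule.mem_sha_iff _ y).1 hy v
    rw [hv, map_zero]
  -- `nat y ∘ ∂h = −(Φ⁻¹(κ_* y) ∘ ∂h)`
  change classBarInv K ((-((extOneEquiv ρ₀).symm (galoisCohomology.map κ 1 y))).comp
    (boundary (presentationComplex_shortExact ρ₀) (classBarD K) h) (rfl : 1 + 1 = 2)) = 0
  rw [Abelian.Ext.neg_comp, map_neg, hvan _ hκy, neg_zero]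

end Summit.BirchSwinnertonDyer.BirchSwinnertonDyer.Theorems.ShaTwoCochainTheta

end
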